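import Literature.AnabelianGeometry.EtaleTheta.SettingModelTatePairKernelNontrivial
import Literature.AnabelianGeometry.EtaleTheta.CyclotomeZHatSign
import Literature.AnabelianGeometry.EtaleTheta.ZHatPadicCharacterSurjective
import Mathlib.GroupTheory.SemidirectProduct
import HarnessLib

/-!
# [EtTh] Remark 1.10.4 (ii): the TOY NO-GO «for `Π = Ẑ(1) ⋊ G_K` the tautological Kummer class fails the
# `±1`-rigidity analogue of Theorem 1.10 (i)» (proof-only)

S. Mochizuki, *The étale theta function and its Frobenioid-theoretic manifestations*, Publ. RIMS **45** (2009),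
Remark 1.10.4 (ii), PRIMS PDF p. 34 (printed p. 260) l. 4–17: "Even if one allows oneself to consider 'Kummer classes'
`κ ∈ H¹(Π, Ẑ(1))` for `Π` an arbitrary topological group that surjects onto the absolute Galois group `G_K` … if `κ` is
to give rise to a nontrivial function, then it is natural to assume that it must induce an isomorphism of some isomorph
of `Ẑ(1)` inside `Π` onto `Ẑ(1)` [cf. the role of `Δ_Θ` in Proposition 1.3 …]. On the other hand, if, for instance,
`Π = Ẑ(1) ⋊ G_K`, then … it is easy to see that the resulting `κ` fails to satisfy the analogue of the rigidity property
of Theorem 1.10, (i)" — Thm. 1.10 (i), p. 30 (printed 256): standard type is "a property that determines this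
collection of classes up to multiplication by `±1`". [cite: MochizukiEtTh2009, Rmk 1.10.4 (ii) p.34 (printed p.260)]

abc-iut cell, layer L2 = [EtTh], seat abc-iut-w6-d054 (gen 7); abc-iut-L2-lead ROWS #139 R1106, RMK-DOC census
class R-b, row «RMK1104ii-TOY-NOGO» (cone node `EtTh:Rmk1.10.4(ii)`, `documented:p407956`).  PROOF-ONLY (0 `def`,
0 instance, 0 notation, no `Prop`-valued fact): the toy group is Mathlib's `SemidirectProduct` of the tree's
`SettingModel.ZH = Ẑ` (`SettingModel2Curve.lean`) by ANY action `ψ : G →* Aut(Ẑ)` — in print `ψ :=` the cyclotomic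
character of `G_K`, i.e. the tree's `SettingModel.chi p : G_{ℚ_p} →* Aut(Ẑ)` (`SettingModelCyclotomicCharacter.lean`)
restricted to `G_K ≤ G_{ℚ_p}`; consumed BY NAME: `SettingModel.mulAut_ZH_comm` (`Aut(Ẑ) = Ẑ^×` is commutative),
`ZHatLevel.negOneAut` / `levelChar_negOneAut` (the sign `−1 ∈ Ẑ^×`, `CyclotomeZHatSign.lean`),
`ZHatLevel.padicChar_surjective_units` / `eq_padicChar_of_toZModPow` (`Ẑ^× ↠ ℤ_p^×`, `ZHatPadicCharacter*.lean`).

WHAT IS PROVED.  Write `Π := Ẑ ⋊[ψ] G`, `κ₀ := SemidirectProduct.left : Π → Ẑ` — the TAUTOLOGICAL Kummer cocycle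
(`κ₀(xy) = κ₀(x) · ψ(x̄)(κ₀(y))`, `kummerLeft_mul`), whose restriction to the cyclotome `Ẑ(1) = inl(Ẑ) ⊴ Π` is the
identity (`kummerLeft_inl`) — exactly print's «induce[s] an isomorphism of some isomorph of `Ẑ(1)` inside `Π` onto `Ẑ(1)`».
* `exists_mulEquiv_over_restrict` — **for EVERY `u ∈ Aut(Ẑ) = Ẑ^×` there is an automorphism `Φ_u` of `Π` OVER `G`
  (`(Φ_u x)̄ = x̄`) restricting to `u` on `Ẑ(1)` and pulling `κ₀` back to `u ∘ κ₀`** (`Φ_u ⟨t, g⟩ := ⟨u t, g⟩`; a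
  homomorphism because `Ẑ^×` is commutative).  So `Aut_G(Π)` moves `κ₀` through the WHOLE of `Ẑ^×`.
* `exists_mulAut_ZH_ne_one_ne_negOne` — **`Ẑ^× ⊋ {±1}`**: some `u ∈ Aut(Ẑ)` is neither `1` nor `−1` (its `3`-adic
  character is `4`, via `Ẑ^× ↠ ℤ₃^×`).
* `rmk1104ii_toy_noGo` — **THE NO-GO**: there is an automorphism of `Π = Ẑ ⋊[ψ] G` over `G` whose restriction to
  `Ẑ(1)` is NEITHER the identity NOR inversion, and which pulls `κ₀` back to `u ∘ κ₀` with `u ∉ {±1}`; in particular for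
  print's `Π = Ẑ(1) ⋊ G_K` (`ψ := χ|_{G_K}`, `rmk1104ii_toy_noGo_galois`).  Since the restriction of a class to the
  (trivially acting) cyclotome `Ẑ(1)` is insensitive to coboundaries, this is a CLASS-level failure of the
  «determined up to `±1`» analogue of Thm. 1.10 (i) — the contrast print draws with the slim, anabelian `Π^tp_X`.
HONEST FRAMING: classical group theory about a TOY group; it documents the printed remark's negative example and
asserts nothing about tempered fundamental groups or about [EtTh]'s positive results; no side is taken on
[IUTchIII] Cor. 3.12; typed ≠ proved elsewhere; here proved exactly as stated.
-/

noncomputable section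

open CategoryTheory ProfiniteGrp ProfiniteGrp.ProfiniteCompletion

namespace Literature.AnabelianGeometry.EtaleTheta

namespace Rmk1104ii

open SettingModel ZHatLevel
open Literature.AnabelianGeometry.SemiGraphs (GQp)

universe u

variable {G : Type u} [Group G] (ψ : G →* MulAut ZH)

/-! ### The tautological Kummer cocycle of `Ẑ ⋊[ψ] G` -/

/-- **The tautological Kummer cocycle is a crossed homomorphism**: `κ₀(xy) = κ₀(x) · ψ(x̄)(κ₀(y))` for
`κ₀ := SemidirectProduct.left` («Kummer classes `κ ∈ H¹(Π, Ẑ(1))`»). [cite: MochizukiEtTh2009, Rmk 1.10.4 (ii) p.34 (printed p.260)] -/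
theorem kummerLeft_mul (x y : ZH ⋊[ψ] G) : (x * y).left = x.left * ψ x.right y.left :=
  SemidirectProduct.mul_left x y

/-- **Its restriction to the cyclotome `Ẑ(1) = inl(Ẑ) ⊴ Π` is the identity** («induce[s] an isomorphism of some
isomorph of `Ẑ(1)` inside `Π` onto `Ẑ(1)`»). [cite: MochizukiEtTh2009, Rmk 1.10.4 (ii) p.34 (printed p.260)] -/
theorem kummerLeft_inl (t : ZH) : (SemidirectProduct.inl t : ZH ⋊[ψ] G).left = t :=
  SemidirectProduct.left_inl t

/-! ### Every unit of `Ẑ` is realised by an automorphism over `G` -/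

/-- **For every `u ∈ Aut(Ẑ) = Ẑ^×` there is an automorphism `Φ_u` of `Π = Ẑ ⋊[ψ] G` OVER `G` restricting to `u` on
`Ẑ(1)` and pulling the tautological Kummer cocycle back to `u ∘ κ₀`** (`Φ_u ⟨t, g⟩ = ⟨u t, g⟩`; multiplicative because
`Ẑ^×` is commutative, `SettingModel.mulAut_ZH_comm`).  Hence `Aut_G(Π)` moves `κ₀` through ALL of `Ẑ^×`.
[cite: MochizukiEtTh2009, Rmk 1.10.4 (ii) p.34 (printed p.260)] -/
theorem exists_mulEquiv_over_restrict (u : MulAut ZH) :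
    ∃ Φ : (ZH ⋊[ψ] G) ≃* (ZH ⋊[ψ] G),
      (∀ x, (Φ x).right = x.right) ∧
      (∀ t : ZH, Φ (SemidirectProduct.inl t) = SemidirectProduct.inl (u t)) ∧
      ∀ x, (Φ x).left = u x.left := by
  have hcomm : ∀ (g : G) (t : ZH), u (ψ g t) = ψ g (u t) := fun g t => by
    have h := congrArg (fun w : MulAut ZH => w t) (mulAut_ZH_comm u (ψ g))
    simpa only [MulAut.mul_apply] using h
  refine ⟨{ toFun := fun x => ⟨u x.left, x.right⟩
            invFun := fun x => ⟨u.symm x.left, x.right⟩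
            left_inv := fun x => by ext <;> simp
            right_inv := fun x => by ext <;> simp
            map_mul' := fun x y => by
              ext
              · simp only [SemidirectProduct.mul_left, map_mul, hcomm]
              · simp only [SemidirectProduct.mul_right] },
    fun x => rfl, fun t => ?_, fun x => rfl⟩
  ext
  · simp
  · simp

/-! ### `Ẑ^× ⊋ {±1}` -/

/-- The `p`-adic character of the sign `−1 ∈ Aut(Ẑ)` is `−1` (private twin of abc-iut-L6's
`Literature.IUT.HodgeArakelov.Genuine.padicChar_negOneAut`, `AbsTopMonoidsGenuineIsometriesProofs.lean`, which is NOT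
imported here to keep the layer order L2 ↛ L6). [cite: RibesZalesskii2010, Thm 2.7.1] -/
private theorem padicChar_negOneAut' (p : ℕ) [Fact p.Prime] : padicChar p negOneAut = -1 := by
  symm
  refine eq_padicChar_of_toZModPow p fun k => ?_
  rw [map_neg, map_one, levelChar_negOneAut]
  rfl

/-- **`Ẑ^× ⊋ {±1}`**: some `u ∈ Aut(Ẑ)` is neither the identity nor inversion — take any `u` with `3`-adic character
`4 ∈ ℤ₃^×` (`Ẑ^× ↠ ℤ₃^×`, `padicChar_surjective_units`); `4 ≠ 1` and `4 ≠ −1` in `ℤ₃`. [cite: RibesZalesskii2010, Thm 2.7.1] -/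
theorem exists_mulAut_ZH_ne_one_ne_negOne : ∃ u : MulAut ZH, u ≠ 1 ∧ u ≠ negOneAut := by
  haveI : Fact (Nat.Prime 3) := ⟨Nat.prime_three⟩
  -- `4 = 1 + 3` is a `3`-adic unit
  have h4 : IsUnit ((4 : ℤ_[3])) := by
    rw [PadicInt.isUnit_iff]
    have hle : ‖(4 : ℤ_[3])‖ ≤ 1 := PadicInt.norm_le_one _
    have hnlt : ¬ ‖(4 : ℤ_[3])‖ < 1 := by
      have h : ¬ ((3 : ℤ) ∣ (4 : ℤ)) := by decide
      have e : ((4 : ℤ) : ℤ_[3]) = 4 := by norm_num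
      rw [← e, PadicInt.norm_int_lt_one_iff_dvd]
      exact h
    exact le_antisymm hle (not_lt.mp hnlt)
  obtain ⟨u, hu⟩ := padicChar_surjective_units 3 h4.unit
  have hu' : padicChar 3 u = 4 := by rw [hu]; rfl
  refine ⟨u, fun h1 => ?_, fun h2 => ?_⟩
  · rw [h1, map_one] at hu'
    norm_num at hu'
  · rw [h2, padicChar_negOneAut'] at hu'
    have h3 : (3 : ℤ_[3]) ≠ 0 := by exact_mod_cast (show (3 : ℕ) ≠ 0 by decide)
    -- `-1 = 4` would give `5 = 0`, but `‖5‖₃ = 1`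
    have h5 : ((5 : ℤ) : ℤ_[3]) ≠ 0 := by
      intro h0
      have hlt : ‖((5 : ℤ) : ℤ_[3])‖ < 1 := by rw [h0, norm_zero]; exact zero_lt_one
      rw [PadicInt.norm_int_lt_one_iff_dvd] at hlt
      exact absurd hlt (by decide)
    apply h5
    have e : ((5 : ℤ) : ℤ_[3]) = 4 + 1 := by norm_num
    rw [e, ← hu']
    norm_num

/-! ### The no-go -/

/-- **[EtTh] Rmk. 1.10.4 (ii) — TOY NO-GO.**  For `Π := Ẑ ⋊[ψ] G` (any action `ψ` of any group `G` on `Ẑ`; print: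
`G = G_K`, `ψ` its cyclotomic character) there is an automorphism `Φ` of `Π` OVER `G` whose restriction to the
cyclotome `Ẑ(1) ⊴ Π` is `u ∈ Ẑ^×` with `u ≠ 1`, `u ≠ −1`, and which pulls the tautological Kummer cocycle `κ₀` back to
`u ∘ κ₀`.  Since restriction to the (trivially acting) cyclotome kills coboundaries, the class of `κ₀` is NOT determined
«up to multiplication by `±1`» by the group `Π ↠ G` — the analogue of the rigidity of Thm. 1.10 (i) FAILS, as the
remark says. [cite: MochizukiEtTh2009, Rmk 1.10.4 (ii) p.34 (printed p.260)] -/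
theorem rmk1104ii_toy_noGo :
    ∃ (Φ : (ZH ⋊[ψ] G) ≃* (ZH ⋊[ψ] G)) (u : MulAut ZH),
      u ≠ 1 ∧ u ≠ negOneAut ∧
      (∀ x, (Φ x).right = x.right) ∧
      (∀ t : ZH, Φ (SemidirectProduct.inl t) = SemidirectProduct.inl (u t)) ∧
      ∀ x, (Φ x).left = u x.left := by
  obtain ⟨u, hu1, hu2⟩ := exists_mulAut_ZH_ne_one_ne_negOne
  obtain ⟨Φ, h1, h2, h3⟩ := exists_mulEquiv_over_restrict ψ u
  exact ⟨Φ, u, hu1, hu2, h1, h2, h3⟩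

/-- **The printed instance `Π = Ẑ(1) ⋊ G_K`**: for a closed subgroup `G_K ≤ G_{ℚ_p}` (the absolute Galois group of a
finite extension `K/ℚ_p`, acting on `Ẑ(1)` through the cyclotomic character `χ|_{G_K}`, the tree's
`SettingModel.chi p`), the no-go above. [cite: MochizukiEtTh2009, Rmk 1.10.4 (ii) p.34 (printed p.260)] -/
theorem rmk1104ii_toy_noGo_galois (p : ℕ) [Fact p.Prime] (GK : Subgroup (GQp p)) :
    ∃ (Φ : (ZH ⋊[(chi p).comp GK.subtype] GK) ≃* (ZH ⋊[(chi p).comp GK.subtype] GK)) (u : MulAut ZH),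
      u ≠ 1 ∧ u ≠ negOneAut ∧
      (∀ x, (Φ x).right = x.right) ∧
      (∀ t : ZH, Φ (SemidirectProduct.inl t) = SemidirectProduct.inl (u t)) ∧
      ∀ x, (Φ x).left = u x.left :=
  rmk1104ii_toy_noGo ((chi p).comp GK.subtype)

/-- **Contrast, in one line**: over `G`, BOTH signs AND a third unit are realised on `Ẑ(1)` by automorphisms of
`Ẑ ⋊[ψ] G` — `1`, `−1` (inversion) and some `u ∉ {±1}` — so the orbit of `κ₀|_{Ẑ(1)} = id` under `Aut_G(Π)` has at
least three members, versus the two (`±`) that Thm. 1.10 (i) allows for the étale theta class.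
[cite: MochizukiEtTh2009, Thm 1.10 (i) p.30 (printed p.256)] -/
theorem three_restrictions_realised :
    ∃ u : MulAut ZH, u ≠ 1 ∧ u ≠ negOneAut ∧
      ∀ w ∈ ({1, negOneAut, u} : Set (MulAut ZH)),
        ∃ Φ : (ZH ⋊[ψ] G) ≃* (ZH ⋊[ψ] G),
          (∀ x, (Φ x).right = x.right) ∧ ∀ t : ZH, Φ (SemidirectProduct.inl t) = SemidirectProduct.inl (w t) := by
  obtain ⟨u, hu1, hu2⟩ := exists_mulAut_ZH_ne_one_ne_negOne
  refine ⟨u, hu1, hu2, fun w _ => ?_⟩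
  obtain ⟨Φ, h1, h2, -⟩ := exists_mulEquiv_over_restrict ψ w
  exact ⟨Φ, h1, h2⟩

end Rmk1104ii

end Literature.AnabelianGeometry.EtaleTheta

end
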